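import Mathlib
import HarnessLib
import Summits.Ventures.LatticeQCDFlow.Exactness.SUNMetropolisORSweepErgodic
import Summits.Ventures.LatticeQCDFlow.Exactness.NCMCGeneralSpaceDoeblinPowerCLT
import Summits.Ventures.LatticeQCDFlow.Scoring.DoeblinPowerBatchMeansCLT
import Summits.Ventures.LatticeQCDFlow.Scoring.DoeblinPowerBatchMeansTauInt

/-!
# The engine's `'metro' + n_or × 'or'` composite on `SU(N)` as run: its Doeblin certificate, and what it buys — every event a finite `τ_int`, a certified burn-in `B/n`, the CLT and asymptotically exact batch-means error bars from EVERY start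

HONEST FRAMING: exact (Metropolis-corrected) sampling algorithms for lattice gauge theory;
figures of merit are autocorrelation/cost numbers at stated couplings and volumes; no
continuum-physics claim.

Venture `LatticeQCDFlow` (cell pub-lqcd), topic `Exactness`, FANOUT row 9 (eng-latcore, GEN-23; the engine
`latflow.core.updates.composite_sweep(f, β, 'metro', n_or)`: one `N`-hit Metropolis link sweep with the
exponential kick `sunMetropolisKick N s`, then `n_or` Cabibbo–Marinari over-relaxation sweeps).  NEW WORK of the
cell over the tree, nothing cited as a fact, no number claimed: gen-21's `SUNMetropolisORSweepErgodic.lean`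
(`wilson_sunMetropolis_orSweep_uniformlyErgodic` — convergence + uniqueness, Doeblin power inside the proof;
`cmORSweep_invariant_gibbsProbability`), gen-22's `MetropolisSweepExactStepErgodic.lean` §2
(`metropolisSweep_exactStep_nHit_minorised` — the Doeblin power of "sweep, then ANY exact step", stated),
`KickLawsNearIdentity.lean` (`exists_smul_haar_restrict_le_sunMetropolisKick`), `MetropolisSweepInstances.lean`
(`wilsonBoltzmann_pinched`, `gibbsProbability_eq_wilsonMeasure`), row 13's `NCMCGeneralSpaceDoeblinPower*.lean`
and row 8's `Scoring/DoeblinPowerBatchMeans*.lean` (the `…_of_nHit` consequences).  Row 8's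
`Scoring/MetropolisSweepBatchMeans.lean` is the error-bar theory of the Metropolis sweep ALONE; this file is the
engine's COMPOSITE with the over-relaxation sweeps, as `composite_sweep` runs it.  Printed counterparts NAMED
ONLY: Creutz 1987 / Brown–Woch 1987 (over-relaxation), Cabibbo–Marinari 1982; Meyn–Tweedie 1993 ch. 16–17;
Flegal–Jones 2010; Madras–Sokal 1988.

## Content (torus `(ℤ/L)^d`, `L ≥ 2`, `G = SU(N)` in the defining representation `suRep N`, `N ≥ 1`, any real
## `β`, kick size `s > 0`, `nhit ≥ 1`, a Metropolis scan `Ls` through every link, ANY OR schedule `sched`;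
## `K = cmORSweep sched ∘ₖ metropolisSweep (sunMetropolisKick N s) e^{−βS_W} nhit Ls`, `π = wilsonMeasure (suRep N) β`)

* §1 **`wilson_sunMetropolis_orSweep_certificate`** — `K` leaves `π` invariant and `ε' • π ≤ K^m(U, ·)` for
  EVERY `U`, some `m > 0`, `0 < ε' ≤ 1`.
* §2 IN EQUILIBRIUM / BURN-IN: **`wilson_sunMetropolis_orSweep_tauInt_setACF_le`** — ONE `B ≥ 0` with
  `τ_int(1_A) ≤ 1/2 + B/(1 − π(A))` for EVERY event `A` with `0 < π(A) < 1`;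
  **`wilson_sunMetropolis_orSweep_timeAverage_bias_le`** — ONE `B ≥ 0` with
  `|E_{μ₀}[(1/n) Σ_{t<n} g(U_t)] − π g| ≤ B/n` for EVERY initial law, every `[0,1]`-valued measurable `g`, `n ≥ 1`.
* §3 ERROR BARS (every bounded measurable `f`, EVERY initial law): **`wilson_sunMetropolis_orSweep_timeAverage_clt`**,
  **`wilson_sunMetropolis_orSweep_batchMeans_tendstoInMeasure`**, **`wilson_sunMetropolis_orSweep_batchMeans_coverage`**
  (`σ²_f > 0`), **`wilson_sunMetropolis_orSweep_tauInt_tendstoInMeasure`** (`Var_π f ≠ 0`).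

NOT CLAIMED: any value of `m, ε', B` (compactness / inverse-function constants — astronomically weak; the
MEASURED `τ_int` stays the figure of merit); `L = 1`; the `U(1)` / `SU(2)`-Pauli-kick instances; floating point
and the engine's `k ≤ 10⁻¹²` OR skip.
-/

noncomputable section

namespace Summit.Ventures.LatticeQCDFlow.Exactness

open MeasureTheory Measure Set Filter Topology Function ProbabilityTheory ProbabilityTheory.Kernel
open Literature.MathematicalPhysics.QuantumFieldTheory
open Literature.MathematicalPhysics.QuantumLattice (connectedSpace_specialUnitaryGroup)
open Summit.Ventures.LatticeQCDFlow.Scoring (replicaSEsq tauInt autocov kop)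
open scoped ENNReal

variable (N : ℕ) (s : ℝ) [Fact (0 < s)] [NeZero N]
variable {d L : ℕ} {m : Type*} [Fintype m] [DecidableEq m]

/-! ## §1 The certificate -/

omit [NeZero N] in
/-- The Wilson measure `wilsonMeasure (suRep N) β` is a probability law. -/
theorem isProbabilityMeasure_wilsonMeasure_suRep [NeZero L] (β : ℝ) :
    IsProbabilityMeasure (wilsonMeasure (d := d) (L := L) (suRep N) β) :=
  isProbabilityMeasure_wilsonMeasure _ continuous_suRep β

/-- **THE DOEBLIN CERTIFICATE OF THE ENGINE'S `'metro' + n_or × 'or'` COMPOSITE ON `SU(N)` AS RUN** (`L ≥ 2`,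
any `β`, kick size `s > 0`, `nhit ≥ 1`, scan `Ls` through every link, ANY OR schedule `sched`): the composite
leaves `wilsonMeasure (suRep N) β` invariant, and some power of it dominates `ε' · wilsonMeasure (suRep N) β`
from EVERY configuration, `m > 0`, `0 < ε' ≤ 1`. -/
theorem wilson_sunMetropolis_orSweep_certificate [NeZero L] (hL : 2 ≤ L) (β : ℝ) {nhit : ℕ} (hn : 1 ≤ nhit)
    {Ls : List (Edge d L)} (hLs : ∀ e, e ∈ Ls) (sched : List (Edge d L × (Fin N ≃ Fin 2 ⊕ m))) :
    Invariant (cmORSweep sched ∘ₖ metropolisSweep (sunMetropolisKick N s)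
                (fun U : GaugeConfig d L (Matrix.specialUnitaryGroup (Fin N) ℂ) => Real.exp (-β * wilsonAction (suRep N) U)) nhit Ls)
        (wilsonMeasure (d := d) (L := L) (suRep N) β) ∧
      ∃ mm : ℕ, ∃ ε' : ℝ≥0∞, 0 < mm ∧ 0 < ε' ∧ ε' ≤ 1 ∧ ∀ U : GaugeConfig d L (Matrix.specialUnitaryGroup (Fin N) ℂ),
        ε' • wilsonMeasure (d := d) (L := L) (suRep N) β ≤
          nHit (cmORSweep sched ∘ₖ metropolisSweep (sunMetropolisKick N s)
                (fun U : GaugeConfig d L (Matrix.specialUnitaryGroup (Fin N) ℂ) => Real.exp (-β * wilsonAction (suRep N) U)) nhit Ls) mm U := by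
  haveI : ConnectedSpace (Matrix.specialUnitaryGroup (Fin N) ℂ) := connectedSpace_specialUnitaryGroup
  haveI := isProbabilityMeasure_wilsonMeasure_suRep N (d := d) (L := L) β
  obtain ⟨V, hV, a, ha, hν⟩ := exists_smul_haar_restrict_le_sunMetropolisKick N s
  obtain ⟨s₀, hlo, hhi, hmeas⟩ := wilsonBoltzmann_pinched (d := d) (L := L) (suRep N) continuous_suRep β
  haveI := isMarkovKernel_metropolisSweep (ι := Edge d L) (sunMetropolisKick N s) hmeas nhit Ls
  have hP := cmORSweep_invariant_gibbsProbability N hL β sched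
  have hS : Invariant (metropolisSweep (sunMetropolisKick N s)
                (fun U : GaugeConfig d L (Matrix.specialUnitaryGroup (Fin N) ℂ) => Real.exp (-β * wilsonAction (suRep N) U)) nhit Ls)
      (gibbsProbability (Measure.pi fun _ : Edge d L => haarProbability (Matrix.specialUnitaryGroup (Fin N) ℂ))
        fun U : GaugeConfig d L (Matrix.specialUnitaryGroup (Fin N) ℂ) => Real.exp (-β * wilsonAction (suRep N) U)) :=
    invariant_gibbsProbability (metropolisSweep_invariant (sunMetropolisKick N s) hmeas
      (fun U => (Real.exp_pos _).trans_le (hlo U)) nhit Ls)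
  obtain ⟨mm, a', ha', hmin⟩ := metropolisSweep_exactStep_nHit_minorised ha hV hν hmeas (Real.exp_pos _) hlo hhi
    hn hLs (cmORSweep sched) hP
  rw [gibbsProbability_eq_wilsonMeasure] at hP hS hmin
  refine ⟨hP.comp hS, mm + 1, a', Nat.succ_pos mm, pos_iff_ne_zero.2 ha', ?_, hmin⟩
  haveI : IsMarkovKernel (nHit (cmORSweep sched ∘ₖ metropolisSweep (sunMetropolisKick N s)
                (fun U : GaugeConfig d L (Matrix.specialUnitaryGroup (Fin N) ℂ) => Real.exp (-β * wilsonAction (suRep N) U)) nhit Ls) (mm + 1)) :=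
    isMarkovKernel_nHit _ _
  have h1 := Measure.le_iff'.1 (hmin fun _ => 1) univ
  rwa [Measure.smul_apply, smul_eq_mul, measure_univ, measure_univ, mul_one] at h1

/-! ## §2 In equilibrium and from every start: `τ_int` of every event, certified burn-in -/

/-- **EVERY EVENT HAS A FINITE `τ_int` UNDER THE ENGINE'S `'metro' + n_or × 'or'` COMPOSITE — ONE CONSTANT FOR
ALL EVENTS**: there is `B ≥ 0` with `τ_int(1_A) = 1/2 + Σ_{t≥1} ρ_A(t) ≤ 1/2 + B/(1 − π(A))` (scorers'
`Scoring.tauInt`) for EVERY measurable `A` with `0 < π(A) < 1`, `π = wilsonMeasure (suRep N) β`. -/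
theorem wilson_sunMetropolis_orSweep_tauInt_setACF_le [NeZero L] (hL : 2 ≤ L) (β : ℝ) {nhit : ℕ} (hn : 1 ≤ nhit)
    {Ls : List (Edge d L)} (hLs : ∀ e, e ∈ Ls) (sched : List (Edge d L × (Fin N ≃ Fin 2 ⊕ m))) :
    ∃ B : ℝ, 0 ≤ B ∧ ∀ A : Set (GaugeConfig d L (Matrix.specialUnitaryGroup (Fin N) ℂ)), MeasurableSet A →
      0 < (wilsonMeasure (d := d) (L := L) (suRep N) β).real A → (wilsonMeasure (d := d) (L := L) (suRep N) β).real A < 1 →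
      tauInt (setACF (cmORSweep sched ∘ₖ metropolisSweep (sunMetropolisKick N s)
                (fun U : GaugeConfig d L (Matrix.specialUnitaryGroup (Fin N) ℂ) => Real.exp (-β * wilsonAction (suRep N) U)) nhit Ls)
          (wilsonMeasure (d := d) (L := L) (suRep N) β) A) ≤
        1 / 2 + B / (1 - (wilsonMeasure (d := d) (L := L) (suRep N) β).real A) := by
  haveI := isProbabilityMeasure_wilsonMeasure_suRep N (d := d) (L := L) β
  obtain ⟨hinv, mm, ε', hmm, hε0, hε1, hmin⟩ :=
    wilson_sunMetropolis_orSweep_certificate N s (d := d) hL β hn hLs sched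
  obtain ⟨s₀, -, -, hmeas⟩ := wilsonBoltzmann_pinched (d := d) (L := L) (suRep N) continuous_suRep β
  haveI := isMarkovKernel_metropolisSweep (ι := Edge d L) (sunMetropolisKick N s) hmeas nhit Ls
  have he0 : 0 < ε'.toReal := ENNReal.toReal_pos hε0.ne' (ne_top_of_le_ne_top ENNReal.one_ne_top hε1)
  have he1 : ε'.toReal ≤ 1 := ENNReal.toReal_le_of_le_ofReal zero_le_one (by simpa using hε1)
  have hmm1 : (1 : ℝ) ≤ mm := by exact_mod_cast hmm
  refine ⟨(mm : ℝ) / ε'.toReal - 1, ?_, fun A hA h0 h1 => ?_⟩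
  · rw [sub_nonneg, le_div_iff₀ he0]; nlinarith
  · exact GeneralNCMC.tauInt_setACF_le_of_nHit (GeneralNCMC.minorised_setwise hmin) hε0 hε1 hmm hinv hA h0 h1

/-- **CERTIFIED BURN-IN OF THE `'metro' + n_or × 'or'` COMPOSITE FROM EVERY START**: one `B ≥ 0` with
`|E_{μ₀}[(1/n) Σ_{t<n} g(U_t)] − ∫ g dπ| ≤ B/n` for EVERY initial law `μ₀`, every `[0,1]`-valued measurable `g`,
every `n ≥ 1`. -/
theorem wilson_sunMetropolis_orSweep_timeAverage_bias_le [NeZero L] (hL : 2 ≤ L) (β : ℝ) {nhit : ℕ} (hn : 1 ≤ nhit)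
    {Ls : List (Edge d L)} (hLs : ∀ e, e ∈ Ls) (sched : List (Edge d L × (Fin N ≃ Fin 2 ⊕ m)))
    [IsMarkovKernel (metropolisSweep (sunMetropolisKick N s)
                (fun U : GaugeConfig d L (Matrix.specialUnitaryGroup (Fin N) ℂ) => Real.exp (-β * wilsonAction (suRep N) U)) nhit Ls)] :
    ∃ B : ℝ, 0 ≤ B ∧ ∀ (μ₀ : Measure (GaugeConfig d L (Matrix.specialUnitaryGroup (Fin N) ℂ))) [IsProbabilityMeasure μ₀]
      (g : GaugeConfig d L (Matrix.specialUnitaryGroup (Fin N) ℂ) → ℝ), Measurable g → (∀ U, 0 ≤ g U) → (∀ U, g U ≤ 1) →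
      ∀ n : ℕ, n ≠ 0 →
      |∫ x, (∑ t ∈ Finset.range n, g (x t)) / n
          ∂(Kernel.trajMeasure (X := fun _ : ℕ => GaugeConfig d L (Matrix.specialUnitaryGroup (Fin N) ℂ)) μ₀
              (fun t : ℕ => (cmORSweep sched ∘ₖ metropolisSweep (sunMetropolisKick N s)
                (fun U : GaugeConfig d L (Matrix.specialUnitaryGroup (Fin N) ℂ) => Real.exp (-β * wilsonAction (suRep N) U)) nhit Ls).comap
                (fun h : (i : ↥(Finset.Iic t)) → GaugeConfig d L (Matrix.specialUnitaryGroup (Fin N) ℂ) =>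
                  h ⟨t, Finset.mem_Iic.2 le_rfl⟩) (measurable_pi_apply _)))
        - ∫ U, g U ∂(wilsonMeasure (d := d) (L := L) (suRep N) β)| ≤ B / n := by
  haveI := isProbabilityMeasure_wilsonMeasure_suRep N (d := d) (L := L) β
  obtain ⟨hinv, mm, ε', hmm, hε0, hε1, hmin⟩ :=
    wilson_sunMetropolis_orSweep_certificate N s (d := d) hL β hn hLs sched
  have he0 : 0 < ε'.toReal := ENNReal.toReal_pos hε0.ne' (ne_top_of_le_ne_top ENNReal.one_ne_top hε1)
  refine ⟨(mm : ℝ) / ε'.toReal, by positivity, fun μ₀ _ g hg h0 h1 n hn0 => ?_⟩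
  calc _ ≤ (mm : ℝ) / (ε'.toReal * n) :=
        GeneralNCMC.chain_timeAverage_bias_le_of_nHit (GeneralNCMC.minorised_setwise hmin) hε0 hε1 hmm hinv μ₀
          hg h0 h1 hn0
    _ = (mm : ℝ) / ε'.toReal / n := by rw [div_div]

/-! ## §3 Error bars from every start: CLT, batch means, coverage, `τ̂_int` -/

/-- **THE CLT FOR TIME AVERAGES OF THE `'metro' + n_or × 'or'` COMPOSITE, FROM EVERY INITIAL LAW**: `|f| ≤ C`
measurable, `Y ~ N(0, σ²_f)` (the composite's Green–Kubo variance): `(√n)⁻¹ Σ_{t<n} (f(U_t) − π f) ⇒ Y` under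
`P_{μ₀}` (the bracketed path-law instance is Mathlib's, spelled out as in row 13's theorem). -/
theorem wilson_sunMetropolis_orSweep_timeAverage_clt [NeZero L] (hL : 2 ≤ L) (β : ℝ) {nhit : ℕ} (hn : 1 ≤ nhit)
    {Ls : List (Edge d L)} (hLs : ∀ e, e ∈ Ls) (sched : List (Edge d L × (Fin N ≃ Fin 2 ⊕ m)))
    [IsMarkovKernel (metropolisSweep (sunMetropolisKick N s)
                (fun U : GaugeConfig d L (Matrix.specialUnitaryGroup (Fin N) ℂ) => Real.exp (-β * wilsonAction (suRep N) U)) nhit Ls)]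
    {f : GaugeConfig d L (Matrix.specialUnitaryGroup (Fin N) ℂ) → ℝ} (hf : Measurable f) {C : ℝ} (hC : ∀ U, |f U| ≤ C)
    (μ₀ : Measure (GaugeConfig d L (Matrix.specialUnitaryGroup (Fin N) ℂ))) [IsProbabilityMeasure μ₀]
    [IsProbabilityMeasure (Kernel.trajMeasure (X := fun _ : ℕ => GaugeConfig d L (Matrix.specialUnitaryGroup (Fin N) ℂ)) μ₀
              (fun t : ℕ => (cmORSweep sched ∘ₖ metropolisSweep (sunMetropolisKick N s)
                (fun U : GaugeConfig d L (Matrix.specialUnitaryGroup (Fin N) ℂ) => Real.exp (-β * wilsonAction (suRep N) U)) nhit Ls).comap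
                (fun h : (i : ↥(Finset.Iic t)) → GaugeConfig d L (Matrix.specialUnitaryGroup (Fin N) ℂ) =>
                  h ⟨t, Finset.mem_Iic.2 le_rfl⟩) (measurable_pi_apply _)))]
    {Ω' : Type*} [MeasurableSpace Ω'] {P' : Measure Ω'} [IsProbabilityMeasure P'] {Y : Ω' → ℝ}
    (hY : HasLaw Y (gaussianReal 0 (Real.toNNReal
      ((∫ y, (f y - ∫ z, f z ∂(wilsonMeasure (d := d) (L := L) (suRep N) β)) ^ 2 ∂(wilsonMeasure (d := d) (L := L) (suRep N) β))
              + 2 * ∑' k, ∫ y, (f y - ∫ z, f z ∂(wilsonMeasure (d := d) (L := L) (suRep N) β))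
                * (Scoring.kop (cmORSweep sched ∘ₖ metropolisSweep (sunMetropolisKick N s)
                (fun U : GaugeConfig d L (Matrix.specialUnitaryGroup (Fin N) ℂ) => Real.exp (-β * wilsonAction (suRep N) U)) nhit Ls))^[k + 1]
                  (fun y => f y - ∫ z, f z ∂(wilsonMeasure (d := d) (L := L) (suRep N) β)) y ∂(wilsonMeasure (d := d) (L := L) (suRep N) β)))) P') :
    TendstoInDistribution (fun (n : ℕ) (x : ℕ → GaugeConfig d L (Matrix.specialUnitaryGroup (Fin N) ℂ)) =>
        (Real.sqrt n)⁻¹ * ∑ t ∈ Finset.range n, (f (x t) - ∫ z, f z ∂(wilsonMeasure (d := d) (L := L) (suRep N) β)))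
      atTop Y (fun _ => (Kernel.trajMeasure (X := fun _ : ℕ => GaugeConfig d L (Matrix.specialUnitaryGroup (Fin N) ℂ)) μ₀
              (fun t : ℕ => (cmORSweep sched ∘ₖ metropolisSweep (sunMetropolisKick N s)
                (fun U : GaugeConfig d L (Matrix.specialUnitaryGroup (Fin N) ℂ) => Real.exp (-β * wilsonAction (suRep N) U)) nhit Ls).comap
                (fun h : (i : ↥(Finset.Iic t)) → GaugeConfig d L (Matrix.specialUnitaryGroup (Fin N) ℂ) =>
                  h ⟨t, Finset.mem_Iic.2 le_rfl⟩) (measurable_pi_apply _)))) P' := by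
  haveI := isProbabilityMeasure_wilsonMeasure_suRep N (d := d) (L := L) β
  obtain ⟨hinv, mm, ε', hmm, hε0, -, hmin⟩ :=
    wilson_sunMetropolis_orSweep_certificate N s (d := d) hL β hn hLs sched
  exact GeneralNCMC.tendstoInDistribution_timeAverage_of_nHit hinv hε0.ne' hmin hmm hf hC μ₀ hY

/-- **BATCH MEANS ESTIMATE `σ²_f` CONSISTENTLY ALONG THE `'metro' + n_or × 'or'` COMPOSITE, FROM EVERY INITIAL
LAW**: `a b · SE²_BM → σ²_f` in probability as `a, b → ∞`. -/
theorem wilson_sunMetropolis_orSweep_batchMeans_tendstoInMeasure [NeZero L] (hL : 2 ≤ L) (β : ℝ) {nhit : ℕ} (hn : 1 ≤ nhit)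
    {Ls : List (Edge d L)} (hLs : ∀ e, e ∈ Ls) (sched : List (Edge d L × (Fin N ≃ Fin 2 ⊕ m)))
    [IsMarkovKernel (metropolisSweep (sunMetropolisKick N s)
                (fun U : GaugeConfig d L (Matrix.specialUnitaryGroup (Fin N) ℂ) => Real.exp (-β * wilsonAction (suRep N) U)) nhit Ls)]
    {f : GaugeConfig d L (Matrix.specialUnitaryGroup (Fin N) ℂ) → ℝ} (hf : Measurable f) {C : ℝ} (hC : ∀ U, |f U| ≤ C)
    (μ₀ : Measure (GaugeConfig d L (Matrix.specialUnitaryGroup (Fin N) ℂ))) [IsProbabilityMeasure μ₀]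
    {a b' : ℕ → ℕ} (ha : Tendsto a atTop atTop) (hb' : Tendsto b' atTop atTop) :
    TendstoInMeasure (Kernel.trajMeasure (X := fun _ : ℕ => GaugeConfig d L (Matrix.specialUnitaryGroup (Fin N) ℂ)) μ₀
              (fun t : ℕ => (cmORSweep sched ∘ₖ metropolisSweep (sunMetropolisKick N s)
                (fun U : GaugeConfig d L (Matrix.specialUnitaryGroup (Fin N) ℂ) => Real.exp (-β * wilsonAction (suRep N) U)) nhit Ls).comap
                (fun h : (i : ↥(Finset.Iic t)) → GaugeConfig d L (Matrix.specialUnitaryGroup (Fin N) ℂ) =>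
                  h ⟨t, Finset.mem_Iic.2 le_rfl⟩) (measurable_pi_apply _)))
      (fun (n : ℕ) (x : ℕ → GaugeConfig d L (Matrix.specialUnitaryGroup (Fin N) ℂ)) => ((b' n * a n : ℕ) : ℝ)
        * replicaSEsq (fun j (x : ℕ → GaugeConfig d L (Matrix.specialUnitaryGroup (Fin N) ℂ)) =>
            (∑ i ∈ Finset.range (b' n), f (x (b' n * j + i))) / (b' n)) (a n) x)
      atTop (fun _ => (∫ y, (f y - ∫ z, f z ∂(wilsonMeasure (d := d) (L := L) (suRep N) β)) ^ 2 ∂(wilsonMeasure (d := d) (L := L) (suRep N) β))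
              + 2 * ∑' k, ∫ y, (f y - ∫ z, f z ∂(wilsonMeasure (d := d) (L := L) (suRep N) β))
                * (Scoring.kop (cmORSweep sched ∘ₖ metropolisSweep (sunMetropolisKick N s)
                (fun U : GaugeConfig d L (Matrix.specialUnitaryGroup (Fin N) ℂ) => Real.exp (-β * wilsonAction (suRep N) U)) nhit Ls))^[k + 1]
                  (fun y => f y - ∫ z, f z ∂(wilsonMeasure (d := d) (L := L) (suRep N) β)) y ∂(wilsonMeasure (d := d) (L := L) (suRep N) β)) := by
  haveI := isProbabilityMeasure_wilsonMeasure_suRep N (d := d) (L := L) β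
  obtain ⟨hinv, mm, ε', hmm, hε0, hε1, hmin⟩ :=
    wilson_sunMetropolis_orSweep_certificate N s (d := d) hL β hn hLs sched
  exact Scoring.chain_batchMeans_sigmaHat_tendstoInMeasure_of_nHit hinv (GeneralNCMC.minorised_setwise hmin)
    hε0 hε1 hmm hf hC μ₀ ha hb'

/-- **THE BATCH-MEANS INTERVAL OF A `'metro' + n_or × 'or'` RUN IS ASYMPTOTICALLY EXACT** (`σ²_f > 0`,
`a, b → ∞`, any initial law, `z > 0`): `P_{μ₀}(|√(ab) (f̄_{ab} − π f)| ≤ z σ̂_BM) → (gaussianReal 0 1)[−z, z]`. -/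
theorem wilson_sunMetropolis_orSweep_batchMeans_coverage [NeZero L] (hL : 2 ≤ L) (β : ℝ) {nhit : ℕ} (hn : 1 ≤ nhit)
    {Ls : List (Edge d L)} (hLs : ∀ e, e ∈ Ls) (sched : List (Edge d L × (Fin N ≃ Fin 2 ⊕ m)))
    [IsMarkovKernel (metropolisSweep (sunMetropolisKick N s)
                (fun U : GaugeConfig d L (Matrix.specialUnitaryGroup (Fin N) ℂ) => Real.exp (-β * wilsonAction (suRep N) U)) nhit Ls)]
    {f : GaugeConfig d L (Matrix.specialUnitaryGroup (Fin N) ℂ) → ℝ} (hf : Measurable f) {C : ℝ} (hC : ∀ U, |f U| ≤ C)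
    (hσ : 0 < (∫ y, (f y - ∫ z, f z ∂(wilsonMeasure (d := d) (L := L) (suRep N) β)) ^ 2 ∂(wilsonMeasure (d := d) (L := L) (suRep N) β))
              + 2 * ∑' k, ∫ y, (f y - ∫ z, f z ∂(wilsonMeasure (d := d) (L := L) (suRep N) β))
                * (Scoring.kop (cmORSweep sched ∘ₖ metropolisSweep (sunMetropolisKick N s)
                (fun U : GaugeConfig d L (Matrix.specialUnitaryGroup (Fin N) ℂ) => Real.exp (-β * wilsonAction (suRep N) U)) nhit Ls))^[k + 1]
                  (fun y => f y - ∫ z, f z ∂(wilsonMeasure (d := d) (L := L) (suRep N) β)) y ∂(wilsonMeasure (d := d) (L := L) (suRep N) β))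
    (μ₀ : Measure (GaugeConfig d L (Matrix.specialUnitaryGroup (Fin N) ℂ))) [IsProbabilityMeasure μ₀]
    {a b' : ℕ → ℕ} (ha : Tendsto a atTop atTop) (hb' : Tendsto b' atTop atTop) {z : ℝ} (hz : 0 < z) :
    Tendsto (fun n : ℕ => (Kernel.trajMeasure (X := fun _ : ℕ => GaugeConfig d L (Matrix.specialUnitaryGroup (Fin N) ℂ)) μ₀
              (fun t : ℕ => (cmORSweep sched ∘ₖ metropolisSweep (sunMetropolisKick N s)
                (fun U : GaugeConfig d L (Matrix.specialUnitaryGroup (Fin N) ℂ) => Real.exp (-β * wilsonAction (suRep N) U)) nhit Ls).comap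
                (fun h : (i : ↥(Finset.Iic t)) → GaugeConfig d L (Matrix.specialUnitaryGroup (Fin N) ℂ) =>
                  h ⟨t, Finset.mem_Iic.2 le_rfl⟩) (measurable_pi_apply _))).real
      {x | |((Real.sqrt ((b' n * a n : ℕ) : ℝ))⁻¹
          * ∑ t ∈ Finset.range (b' n * a n), (f (x t) - ∫ z, f z ∂(wilsonMeasure (d := d) (L := L) (suRep N) β)))
        / Real.sqrt (((b' n * a n : ℕ) : ℝ)
          * replicaSEsq (fun j (x : ℕ → GaugeConfig d L (Matrix.specialUnitaryGroup (Fin N) ℂ)) =>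
              (∑ i ∈ Finset.range (b' n), f (x (b' n * j + i))) / (b' n)) (a n) x)| ≤ z})
      atTop (𝓝 ((gaussianReal 0 1).real (Set.Icc (-z) z))) := by
  haveI := isProbabilityMeasure_wilsonMeasure_suRep N (d := d) (L := L) β
  obtain ⟨hinv, mm, ε', hmm, hε0, hε1, hmin⟩ :=
    wilson_sunMetropolis_orSweep_certificate N s (d := d) hL β hn hLs sched
  exact Scoring.doeblinPower_batchMeans_studentized_coverage hinv hmin hε0 hε1 hmm hf hC hσ μ₀ ha hb' hz

/-- **THE REPORTED `τ̂_int = σ̂²_BM/(2 v̂)` OF A `'metro' + n_or × 'or'` RUN IS CONSISTENT** (`Var_π f ≠ 0`,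
`a, b → ∞`, any initial law): `σ̂²/(2 v̂) → τ_int(ρ_f) = 1/2 + Σ_{t≥1} ρ_f(t)` in probability. -/
theorem wilson_sunMetropolis_orSweep_tauInt_tendstoInMeasure [NeZero L] (hL : 2 ≤ L) (β : ℝ) {nhit : ℕ} (hn : 1 ≤ nhit)
    {Ls : List (Edge d L)} (hLs : ∀ e, e ∈ Ls) (sched : List (Edge d L × (Fin N ≃ Fin 2 ⊕ m)))
    [IsMarkovKernel (metropolisSweep (sunMetropolisKick N s)
                (fun U : GaugeConfig d L (Matrix.specialUnitaryGroup (Fin N) ℂ) => Real.exp (-β * wilsonAction (suRep N) U)) nhit Ls)]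
    {f : GaugeConfig d L (Matrix.specialUnitaryGroup (Fin N) ℂ) → ℝ} (hf : Measurable f) {C : ℝ} (hC : ∀ U, |f U| ≤ C)
    (hvar : autocov (cmORSweep sched ∘ₖ metropolisSweep (sunMetropolisKick N s)
                (fun U : GaugeConfig d L (Matrix.specialUnitaryGroup (Fin N) ℂ) => Real.exp (-β * wilsonAction (suRep N) U)) nhit Ls)
        (wilsonMeasure (d := d) (L := L) (suRep N) β) (fun y => f y - ∫ z, f z ∂(wilsonMeasure (d := d) (L := L) (suRep N) β)) 0 ≠ 0)
    (μ₀ : Measure (GaugeConfig d L (Matrix.specialUnitaryGroup (Fin N) ℂ))) [IsProbabilityMeasure μ₀]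
    {a b' : ℕ → ℕ} (ha : Tendsto a atTop atTop) (hb' : Tendsto b' atTop atTop) :
    TendstoInMeasure (Kernel.trajMeasure (X := fun _ : ℕ => GaugeConfig d L (Matrix.specialUnitaryGroup (Fin N) ℂ)) μ₀
              (fun t : ℕ => (cmORSweep sched ∘ₖ metropolisSweep (sunMetropolisKick N s)
                (fun U : GaugeConfig d L (Matrix.specialUnitaryGroup (Fin N) ℂ) => Real.exp (-β * wilsonAction (suRep N) U)) nhit Ls).comap
                (fun h : (i : ↥(Finset.Iic t)) → GaugeConfig d L (Matrix.specialUnitaryGroup (Fin N) ℂ) =>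
                  h ⟨t, Finset.mem_Iic.2 le_rfl⟩) (measurable_pi_apply _)))
      (fun (n : ℕ) (x : ℕ → GaugeConfig d L (Matrix.specialUnitaryGroup (Fin N) ℂ)) =>
        (((b' n * a n : ℕ) : ℝ)
          * replicaSEsq (fun j (x : ℕ → GaugeConfig d L (Matrix.specialUnitaryGroup (Fin N) ℂ)) =>
              (∑ i ∈ Finset.range (b' n), f (x (b' n * j + i))) / (b' n)) (a n) x)
        / (2 * ((∑ t ∈ Finset.range (b' n * a n), f (x t) ^ 2) / ((b' n * a n : ℕ) : ℝ)
            - ((∑ t ∈ Finset.range (b' n * a n), f (x t)) / ((b' n * a n : ℕ) : ℝ)) ^ 2)))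
      atTop (fun _ => tauInt (fun t =>
        autocov (cmORSweep sched ∘ₖ metropolisSweep (sunMetropolisKick N s)
                (fun U : GaugeConfig d L (Matrix.specialUnitaryGroup (Fin N) ℂ) => Real.exp (-β * wilsonAction (suRep N) U)) nhit Ls)
            (wilsonMeasure (d := d) (L := L) (suRep N) β) (fun y => f y - ∫ z, f z ∂(wilsonMeasure (d := d) (L := L) (suRep N) β)) t
          / autocov (cmORSweep sched ∘ₖ metropolisSweep (sunMetropolisKick N s)
                (fun U : GaugeConfig d L (Matrix.specialUnitaryGroup (Fin N) ℂ) => Real.exp (-β * wilsonAction (suRep N) U)) nhit Ls)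
            (wilsonMeasure (d := d) (L := L) (suRep N) β) (fun y => f y - ∫ z, f z ∂(wilsonMeasure (d := d) (L := L) (suRep N) β)) 0)) := by
  haveI := isProbabilityMeasure_wilsonMeasure_suRep N (d := d) (L := L) β
  obtain ⟨hinv, mm, ε', hmm, hε0, hε1, hmin⟩ :=
    wilson_sunMetropolis_orSweep_certificate N s (d := d) hL β hn hLs sched
  exact Scoring.chain_batchMeans_tauInt_tendstoInMeasure_of_nHit hinv hmin hε0 hε1 hmm hf hC hvar μ₀ ha hb'

end Summit.Ventures.LatticeQCDFlow.Exactness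

end
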